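import Summits.AtomisticToContinuum.Crystallization.Theorems.FrustratedLawDichotomyStrainedPatchHomEntryFitHcpCentredRotKit
import Summits.AtomisticToContinuum.Crystallization.Theorems.FrustratedLawDichotomyStrainedPatchHomEntryFitHcpCentredPair

/-!
# The CENTRED fit verdict WITH THE ROTATION PAYLOAD, soundness: the pair bound against the rotated pattern `R n_k` (hand-1 g31; 27623 (H) hcp half)
`…CentredPair.norm_pair_le_cPairCore` / `…_of_cPairOK` VERBATIM except: pattern direction `n' = R n_k` (`R` = the isometry of `…RotKit.cayQ q`, enclosed by
`qnFI`), centre residual `r_c = R_{c,k} + λ(n_k − n') − (‖N_c‖ − λ)·n'` (`cRcvR`), and `pairResidual_le` applied to `R := R_k + λ(n_k − n')`,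
`R_c := R_{c,k} + λ(n_k − n')` (so `R − R_c = ΔR_k`: every box-variation enclosure of the centred kit is reused unchanged).
Def-free; 0 sorry; standard axioms; no instances / notation / `#eval`.  `--supports stmt-AtomisticToContinuum-27623`.
-/



noncomputable section

namespace Summit.AtomisticToContinuum.Crystallization.Theorems.FrustratedLawDichotomyStrainedPatchHomEntryFitHcpCentred

open scoped BigOperators RealInnerProductSpace Matrix
open Literature.Analysis.ValidatedNumerics.Numerics
open Summit.AtomisticToContinuum.Crystallization.Theorems.ChargedEnergyGapNegative (E3)
open Summit.AtomisticToContinuum.Crystallization.Theorems.FrustratedLawDichotomyStrainedPatchHomSplit (latPt hexFrame hcpShift)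
open Summit.AtomisticToContinuum.Crystallization.Theorems.FrustratedLawDichotomyStrainedPatchHomCoords (apply_eq_sum_entries)
open Summit.AtomisticToContinuum.Crystallization.Theorems.FrustratedLawDichotomyStrainedPatchHomLatticeBoxHcp (latPt_eq_apply_one)
open Summit.AtomisticToContinuum.Crystallization.Theorems.FrustratedLawDichotomyStrainedPatchHomLeafCalculus (inner_eq_sum_apply)
open Summit.AtomisticToContinuum.Crystallization.Theorems.FrustratedLawDichotomyStrainedPatchHomEntryGram (entryFI mem_entryFI)
open Summit.AtomisticToContinuum.Crystallization.Theorems.FrustratedLawDichotomyStrainedPatchHomEntryGramHcp (dot3 shufFI mem_dot3 mem_shufFI)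
open Summit.AtomisticToContinuum.Crystallization.Theorems.FrustratedLawDichotomyStrainedPatchHomEntryFit (scaleL devFI mem_devFI)
open Summit.AtomisticToContinuum.Crystallization.Theorems.FrustratedLawDichotomyStrainedPatchHomEntryHcpFrame (hlab hshift nbr nbrU norm_nbr)
open Summit.AtomisticToContinuum.Crystallization.Theorems.FrustratedLawDichotomyStrainedPatchHomEntryFitHcpSharpKit
  (nbrFI rVec rReal rP rSq nrm2 dlt devH d2S mem_nbrFI mem_rVec nbrU_eq_smul_add_rReal)
open Summit.AtomisticToContinuum.Crystallization.Theorems.FrustratedLawDichotomyStrainedPatchHomCurvCentreKit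
  (zW cenMap cenShuf cenMap_apply cenMap_entry cenMap_box cenShuf_apply cenShuf_box)
open Summit.AtomisticToContinuum.Crystallization.Theorems.FrustratedLawDichotomyStrainedPatchHomEntryFitCentredReal (pairResidual_le)
open Summit.AtomisticToContinuum.Crystallization.Theorems.FrustratedLawDichotomyStrainedPatchHomEntryTable (entries_symm)
open Summit.AtomisticToContinuum.Crystallization.Theorems.FrustratedLawDichotomyStrainedPatchHomForceCentredSound (lo_pos_of_divPos)

variable {c w : (Fin 3 × Fin 3) ⊕ Fin 3 → ℤ}

/-- ★ The CENTRED branch of the ROTATED pair bound (`…CentredPair.norm_pair_le_cPairCore` with pattern `R n_k`). [folklore chaining] -/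
theorem norm_pair_le_cPairCoreR (hsym : c (Sum.inl (1, 0)) = c (Sum.inl (0, 1)) ∧ c (Sum.inl (2, 0)) = c (Sum.inl (0, 2)) ∧ c (Sum.inl (2, 1)) = c (Sum.inl (1, 2)))
    (U : E3 →L[ℝ] E3) (ξ : E3) (hsa : ∀ v v' : E3, ⟪U v, v'⟫ = ⟪v, U v'⟫)
    (hbox : ∀ ab : Fin 3 × Fin 3, |(U (EuclideanSpace.single ab.2 (1 : ℝ))) ab.1 - (c (Sum.inl ab) : ℝ) / SC| ≤ (w (Sum.inl ab) : ℝ) / SC)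
    (hξb : ∀ i : Fin 3, |ξ i - (c (Sum.inr i) : ℝ) / SC| ≤ (w (Sum.inr i) : ℝ) / SC) (k k' : Fin 12)
    (q : Fin 4 → ℤ) (Riso : E3 →ₗᵢ[ℝ] E3) (hRiso : ∀ (x : E3) (i : Fin 3), Riso x i = ∑ j, cayQ q i j * x j) (hNq : 0 < cayN q)
    {e g : Fin 3 → FI} (he : vec3? (cEhR c (scaleL (fun ab => c (Sum.inl ab))) q k k') = some e) (hg : vec3? (cGh c (scaleL (fun ab => c (Sum.inl ab))) k') = some g)
    {B : FI} (hB : cPairCoreR c w (scaleL (fun ab => c (Sum.inl ab))) q k k' e g = some B) :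
    ‖nbrU U ξ k - ‖nbrU U ξ k'‖ • Riso (nbr k)‖ * SC ≤ (B.hi : ℝ) := by
  have hS : (0 : ℝ) < SC := by norm_num [SC]
  have hsym' : ∀ a b : Fin 3, c (Sum.inl (a, b)) = c (Sum.inl (b, a)) := by
    obtain ⟨s1, s2, s3⟩ := hsym
    intro a b
    fin_cases a <;> fin_cases b <;> first | rfl | exact s1.symm | exact s1 | exact s2.symm | exact s2 | exact s3.symm | exact s3
  set cU : Fin 3 × Fin 3 → ℤ := fun ab => c (Sum.inl ab) with hcU
  set L : ℤ := scaleL cU with hL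
  set lam : ℝ := (L : ℝ) / SC with hlam
  set V : E3 →L[ℝ] E3 := U - lam • (1 : E3 →L[ℝ] E3) with hVdef
  set Uc : E3 →L[ℝ] E3 := cenMap c with hUc
  set ξc : E3 := cenShuf c with hξc
  set Vc : E3 →L[ℝ] E3 := Uc - lam • (1 : E3 →L[ℝ] E3) with hVcdef
  have hV : ∀ x : E3, U x = lam • x + V x := fun x => by simp [hVdef]
  have hVc : ∀ x : E3, Uc x = lam • x + Vc x := fun x => by simp [hVcdef]
  set R : Fin 12 → E3 := fun j => rReal V ξ lam j with hRdef
  set Rc : Fin 12 → E3 := fun j => rReal Vc ξc lam j with hRcdef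
  have hdk : ∀ j, nbrU U ξ j = lam • nbr j + R j := fun j => nbrU_eq_smul_add_rReal hV ξ j
  have hdkc : ∀ j, nbrU Uc ξc j = lam • nbr j + Rc j := fun j => nbrU_eq_smul_add_rReal hVc ξc j
  have hX : ∀ i, FI.mem (ξ i) (shufFI c w i) := fun i => mem_shufFI (hξb i)
  have hLm : FI.mem lam (FI.ofScaled L) := FI.mem_ofScaled _
  have hboxc : ∀ ab : Fin 3 × Fin 3, |(Uc (EuclideanSpace.single ab.2 (1 : ℝ))) ab.1 - (c (Sum.inl ab) : ℝ) / SC| ≤ (zW (Sum.inl ab) : ℝ) / SC :=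
    fun ab => cenMap_box c ab
  have hξcb : ∀ i : Fin 3, |ξc i - (c (Sum.inr i) : ℝ) / SC| ≤ (zW (Sum.inr i) : ℝ) / SC := fun i => cenShuf_box c i
  have hE'c : ∀ ab : Fin 3 × Fin 3, FI.mem ((Vc (EuclideanSpace.single ab.2 (1 : ℝ))) ab.1) (cE0 c L ab) :=
    FrustratedLawDichotomyStrainedPatchHomEntryFit.mem_devFI Uc L hboxc
  have hXc : ∀ i, FI.mem (ξc i) (cX0 c i) := fun i => mem_shufFI (hξcb i)
  have hRc : ∀ j a, FI.mem ((Rc j) a) (cRc c L j a) := fun j a => mem_rVec Vc ξc hE'c hXc hLm j a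
  have hΔ : ∀ j a, FI.mem ((R j - Rc j) a) (cDR c w j a) := fun j a => mem_cDR U ξ lam hbox hξb j a
  have hρ : ∀ j, FI.mem ‖R j - Rc j‖ (cRho c w j) := fun j => mem_cRho U ξ lam hbox hξb j
  have hPc : FI.mem ⟪Rc k', nbr k'⟫ (rP (cE0 c L) (cX0 c) (FI.ofScaled L) k') := mem_dot3 (hRc k') (mem_nbrFI k')
  have hQc : FI.mem (‖Rc k'‖ ^ 2) (rSq (cE0 c L) (cX0 c) (FI.ofScaled L) k') := by
    rw [← real_inner_self_eq_norm_sq]; exact mem_dot3 (hRc k') (hRc k')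
  have hlam_nbr : ∀ j, ‖nbrU Uc ξc j‖ ^ 2 = (lam ^ 2 + lam * ⟪Rc j, nbr j⟫ * ((2 : ℤ) : ℝ)) + ‖Rc j‖ ^ 2 := fun j => by
    rw [hdkc, norm_add_sq_real, norm_smul, Real.norm_eq_abs, norm_nbr, mul_one, sq_abs, real_inner_smul_left, real_inner_comm]
    push_cast; ring
  have hNc2 : FI.mem (‖nbrU Uc ξc k'‖ ^ 2) (nrm2 (cE0 c L) (cX0 c) (FI.ofScaled L) k') := by
    rw [hlam_nbr]
    exact FI.mem_add (FI.mem_add (FI.mem_sqr hLm) (FI.mem_mulInt (FI.mem_mul hLm hPc) 2)) hQc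
  have hNcN : FI.mem ‖nbrU Uc ξc k'‖ (cNcN c L k') := by
    have := FI.mem_sqrt hNc2
    rwa [Real.sqrt_sq (norm_nonneg _)] at this
  have hDc : FI.mem (‖nbrU Uc ξc k'‖ - lam) (cDlt c L k') := by
    have := FI.mem_sqrt hNc2
    rw [Real.sqrt_sq (norm_nonneg _)] at this
    exact FI.mem_sub this hLm
  set N : E3 := nbrU U ξ k' with hNdef
  set Nc : E3 := nbrU Uc ξc k' with hNcdef
  set n' : E3 := Riso (nbr k) with hn'def
  have hn' : ‖n'‖ = 1 := by rw [hn'def, Riso.norm_map, norm_nbr]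
  have hNpos : 0 < (cayN q).toNat := by omega
  have hNcast : (((cayN q).toNat : ℕ) : ℝ) = (cayN q : ℝ) := by
    have : ((cayN q).toNat : ℤ) = cayN q := Int.toNat_of_nonneg hNq.le
    exact_mod_cast this
  have hQn : ∀ a, FI.mem (n' a) (qnFI q k a) := fun a => by
    rw [hn'def, hRiso (nbr k) a, Fin.sum_univ_three]
    have e : ∀ j, cayQ q a j = ((cayM q a j : ℤ) : ℝ) / (((cayN q).toNat : ℕ) : ℝ) := fun j => by rw [hNcast]; rfl
    rw [e 0, e 1, e 2]
    exact FI.mem_add (FI.mem_add (FI.mem_mul (FI.mem_ofFrac _ hNpos) (mem_nbrFI k 0)) (FI.mem_mul (FI.mem_ofFrac _ hNpos) (mem_nbrFI k 1)))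
      (FI.mem_mul (FI.mem_ofFrac _ hNpos) (mem_nbrFI k 2))
  set rc : E3 := Rc k + lam • (nbr k - n') - (‖Nc‖ - lam) • n' with hrc
  have hrcv : ∀ a, FI.mem (rc a) (cRcvR c L q k k' a) := fun a => by
    have e : rc a = ((Rc k) a + lam * ((nbr k) a - n' a)) - (‖Nc‖ - lam) * n' a := by
      simp only [hrc, PiLp.sub_apply, PiLp.add_apply, PiLp.smul_apply, smul_eq_mul]
    rw [e]
    exact FI.mem_sub (FI.mem_add (hRc k a) (FI.mem_mul hLm (FI.mem_sub (mem_nbrFI k a) (hQn a)))) (FI.mem_mul hDc (hQn a))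
  have hrcN : FI.mem ‖rc‖ (cRcNR c L q k k') := by
    have h2 : FI.mem (‖rc‖ ^ 2) (dot3 (cRcvR c L q k k') (cRcvR c L q k k')) := by
      rw [← real_inner_self_eq_norm_sq]; exact mem_dot3 hrcv hrcv
    have := FI.mem_sqrt h2
    rwa [Real.sqrt_sq (norm_nonneg _)] at this
  have hNcv : ∀ a, FI.mem (Nc a) (cNc c L k' a) := fun a => by
    have e : Nc a = lam * (nbr k') a + (Rc k') a := by
      simp only [hNcdef, hdkc, PiLp.add_apply, PiLp.smul_apply, smul_eq_mul]
    rw [e]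
    exact FI.mem_add (FI.mem_mul hLm (mem_nbrFI k' a)) (hRc k' a)
  have hsplit : nbrU U ξ k - ‖N‖ • n' = (R k + lam • (nbr k - n')) - (‖N‖ - lam) • n' := by
    rw [hdk, smul_sub, sub_smul]; abel
  have eΔ : R k + lam • (nbr k - n') - (Rc k + lam • (nbr k - n')) = R k - Rc k := by abel
  have hNsub : N - Nc = R k' - Rc k' := by
    simp only [hNdef, hNcdef, hdk, hdkc]; abel
  have hnN : ‖N - Nc‖ = ‖R k' - Rc k'‖ := by rw [hNsub]
  rw [hsplit]
  unfold cPairCoreR at hB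
  obtain ⟨q1, hq1, hB⟩ := Option.bind_eq_some_iff.1 hB
  obtain ⟨q2, hq2, hB⟩ := Option.bind_eq_some_iff.1 hB
  simp only [Option.some.injEq] at hB
  subst hB
  have hrc0 : 0 < ‖rc‖ := pos_of_mem hrcN (lo_pos_of_divPos (vec3?_spec he 0))
  have hNc0 : 0 < ‖Nc‖ := pos_of_mem hNcN (lo_pos_of_divPos (vec3?_spec hg 0))
  have hê : ∀ a, FI.mem (rc a / ‖rc‖) (e a) := fun a => FI.mem_divPos (vec3?_spec he a) (hrcv a) hrcN
  have hĝ : ∀ a, FI.mem (Nc a / ‖Nc‖) (g a) := fun a => FI.mem_divPos (vec3?_spec hg a) (hNcv a) hNcN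
  set en : ℝ := ⟪rc, n'⟫ / ‖rc‖ with hen
  have hen_sum : en = ∑ a : Fin 3, rc a / ‖rc‖ * n' a := by
    rw [hen, inner_eq_sum_apply, Finset.sum_div]
    exact Finset.sum_congr rfl fun a _ => by ring
  have henm : FI.mem en (dot3 e (qnFI q k)) := by
    rw [hen_sum, Fin.sum_univ_three]
    exact FI.mem_add (FI.mem_add (FI.mem_mul (hê 0) (hQn 0)) (FI.mem_mul (hê 1) (hQn 1))) (FI.mem_mul (hê 2) (hQn 2))
  have hden2 : FI.mem ((‖rc‖ - (‖R k - Rc k‖ + ‖N - Nc‖)) * ((2 : ℤ) : ℝ)) (((cRcNR c L q k k').sub ((cRho c w k).add (cRho c w k'))).mulInt 2) := by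
    rw [hnN]; exact FI.mem_mulInt (FI.mem_sub hrcN (FI.mem_add (hρ k) (hρ k'))) 2
  have hden1 : FI.mem ((‖Nc‖ - ‖N - Nc‖) * ((2 : ℤ) : ℝ)) (((cNcN c L k').sub (cRho c w k')).mulInt 2) := by
    rw [hnN]; exact FI.mem_mulInt (FI.mem_sub hNcN (hρ k')) 2
  have hsmall : ‖R k - Rc k‖ + ‖N - Nc‖ < ‖rc‖ := by
    have := pos_of_mem hden2 (lo_pos_of_divPos hq2)
    push_cast at this
    linarith
  have hN' : ‖N - Nc‖ < ‖Nc‖ := by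
    have := pos_of_mem hden1 (lo_pos_of_divPos hq1)
    push_cast at this
    linarith
  have main := pairResidual_le (R k + lam • (nbr k - n')) (Rc k + lam • (nbr k - n')) N Nc n' lam hn' (by rw [eΔ]; exact hsmall) hN'
  rw [eΔ] at main
  set D : E3 →L[ℝ] E3 := U - Uc with hDdef
  have hRk : ∀ j a, (R j - Rc j) a = ∑ b : Fin 3, (D (EuclideanSpace.single b (1 : ℝ))) a * (nbr j + (if hshift j then ξ else 0)) b +
      (if hshift j then ∑ b : Fin 3, (c (Sum.inl (a, b)) : ℝ) / SC * (ξ - ξc) b else 0) := fun j a => by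
    have e1 : R j - Rc j = rReal D ξ 0 j + (if hshift j then Uc (ξ - ξc) else 0) := by
      simp only [hRdef, hRcdef, hVdef, hVcdef, hDdef]
      exact rReal_sub_rReal U Uc ξ ξc lam j
    rw [e1, rReal_zero_eq, PiLp.add_apply, apply_eq_sum_entries]
    congr 1
    cases hshift j
    · simp
    · simp only [↓reduceIte]; rw [hUc, cenMap_apply]
  have hdsym : ∀ a b, (D (EuclideanSpace.single b (1 : ℝ))) a = (D (EuclideanSpace.single a (1 : ℝ))) b := by
    intro a b
    simp only [hDdef]
    have h1 := entries_symm hsa a b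
    have h2 : (Uc (EuclideanSpace.single b (1 : ℝ))) a = (Uc (EuclideanSpace.single a (1 : ℝ))) b := by
      rw [hUc, cenMap_entry, cenMap_entry, hsym' a b]
    have e3 : ∀ x y : Fin 3, (D (EuclideanSpace.single y (1 : ℝ))) x = (U (EuclideanSpace.single y (1 : ℝ))) x - (Uc (EuclideanSpace.single y (1 : ℝ))) x :=
      fun x y => by simp [hDdef]
    rw [e3, e3, h1, h2]
  have hfo : ⟪rc, R k - Rc k⟫ / ‖rc‖ - ⟪rc, n'⟫ / ‖rc‖ * (⟪Nc, N - Nc⟫ / ‖Nc‖) =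
      ((((∑ a : Fin 3, (D (EuclideanSpace.single a (1 : ℝ))) a *
            (rc a / ‖rc‖ * (nbr k + (if hshift k then ξ else 0)) a - en * (Nc a / ‖Nc‖) * (nbr k' + (if hshift k' then ξ else 0)) a)) +
        (D (EuclideanSpace.single 1 (1 : ℝ))) 0 *
            ((rc 0 / ‖rc‖ * (nbr k + (if hshift k then ξ else 0)) 1 - en * (Nc 0 / ‖Nc‖) * (nbr k' + (if hshift k' then ξ else 0)) 1) +
              (rc 1 / ‖rc‖ * (nbr k + (if hshift k then ξ else 0)) 0 - en * (Nc 1 / ‖Nc‖) * (nbr k' + (if hshift k' then ξ else 0)) 0))) +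
          (D (EuclideanSpace.single 2 (1 : ℝ))) 0 *
            ((rc 0 / ‖rc‖ * (nbr k + (if hshift k then ξ else 0)) 2 - en * (Nc 0 / ‖Nc‖) * (nbr k' + (if hshift k' then ξ else 0)) 2) +
              (rc 2 / ‖rc‖ * (nbr k + (if hshift k then ξ else 0)) 0 - en * (Nc 2 / ‖Nc‖) * (nbr k' + (if hshift k' then ξ else 0)) 0))) +
          (D (EuclideanSpace.single 2 (1 : ℝ))) 1 *
            ((rc 1 / ‖rc‖ * (nbr k + (if hshift k then ξ else 0)) 2 - en * (Nc 1 / ‖Nc‖) * (nbr k' + (if hshift k' then ξ else 0)) 2) +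
              (rc 2 / ‖rc‖ * (nbr k + (if hshift k then ξ else 0)) 1 - en * (Nc 2 / ‖Nc‖) * (nbr k' + (if hshift k' then ξ else 0)) 1))) +
      ∑ b : Fin 3, (ξ - ξc) b *
        ((if hshift k then ∑ a : Fin 3, (c (Sum.inl (a, b)) : ℝ) / SC * (rc a / ‖rc‖) else 0) -
          en * (if hshift k' then ∑ a : Fin 3, (c (Sum.inl (a, b)) : ℝ) / SC * (Nc a / ‖Nc‖) else 0)) := by
    have eL : ⟪rc, R k - Rc k⟫ / ‖rc‖ = ∑ a : Fin 3, rc a / ‖rc‖ * (R k - Rc k) a := by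
      rw [inner_eq_sum_apply, Finset.sum_div]; exact Finset.sum_congr rfl fun a _ => by ring
    have eN : ⟪Nc, N - Nc⟫ / ‖Nc‖ = ∑ a : Fin 3, Nc a / ‖Nc‖ * (N - Nc) a := by
      rw [inner_eq_sum_apply, Finset.sum_div]; exact Finset.sum_congr rfl fun a _ => by ring
    rw [eL, eN, ← hen, hNsub]
    simp only [hRk]
    have key := bracket_identity (fun a => rc a / ‖rc‖) (fun a => Nc a / ‖Nc‖) (fun b => (nbr k + (if hshift k then ξ else 0)) b)
      (fun b => (nbr k' + (if hshift k' then ξ else 0)) b) (fun b => (ξ - ξc) b) (fun a b => (D (EuclideanSpace.single b (1 : ℝ))) a)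
      (fun a b => (c (Sum.inl (a, b)) : ℝ) / SC) en (hshift k) (hshift k') (hdsym 1 0) (hdsym 2 0) (hdsym 2 1)
    exact key
  have hM : ∀ j b, FI.mem ((nbr j + (if hshift j then ξ else 0)) b) (cM c w j b) := fun j b => mem_cM hX j b
  have hCU : ∀ a b, FI.mem (rc a / ‖rc‖ * (nbr k + (if hshift k then ξ else 0)) b - en * (Nc a / ‖Nc‖) * (nbr k' + (if hshift k' then ξ else 0)) b)
      (cCU c w k k' e g (dot3 e (qnFI q k)) a b) := fun a b =>
    FI.mem_sub (FI.mem_mul (hê a) (hM k b)) (FI.mem_mul (FI.mem_mul henm (hĝ a)) (hM k' b))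
  have hD : ∀ a b, FI.mem ((D (EuclideanSpace.single b (1 : ℝ))) a) (wdFI w (a, b)) := fun a b => mem_wdFI U hbox (a, b)
  have hCX : ∀ b, FI.mem ((if hshift k then ∑ a : Fin 3, (c (Sum.inl (a, b)) : ℝ) / SC * (rc a / ‖rc‖) else 0) -
      en * (if hshift k' then ∑ a : Fin 3, (c (Sum.inl (a, b)) : ℝ) / SC * (Nc a / ‖Nc‖) else 0)) (cCX c k k' e g (dot3 e (qnFI q k)) b) := by
    intro b
    unfold cCX
    refine FI.mem_sub ?_ (FI.mem_mul henm ?_)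
    · cases hshift k
      · simpa using FI.mem_ofInt 0
      · simp only [↓reduceIte, Fin.sum_univ_three]
        exact FI.mem_add (FI.mem_add (FI.mem_mul (FI.mem_ofScaled _) (hê 0)) (FI.mem_mul (FI.mem_ofScaled _) (hê 1))) (FI.mem_mul (FI.mem_ofScaled _) (hê 2))
    · cases hshift k'
      · simpa using FI.mem_ofInt 0
      · simp only [↓reduceIte, Fin.sum_univ_three]
        exact FI.mem_add (FI.mem_add (FI.mem_mul (FI.mem_ofScaled _) (hĝ 0)) (FI.mem_mul (FI.mem_ofScaled _) (hĝ 1))) (FI.mem_mul (FI.mem_ofScaled _) (hĝ 2))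
  have hTU : FI.mem (⟪rc, R k - Rc k⟫ / ‖rc‖ - ⟪rc, n'⟫ / ‖rc‖ * (⟪Nc, N - Nc⟫ / ‖Nc‖))
      ((cTU c w k k' e g (dot3 e (qnFI q k))).add (cTX c w k k' e g (dot3 e (qnFI q k)))) := by
    rw [hfo]
    refine FI.mem_add ?_ ?_
    · simp only [cTU]
      exact FI.mem_add (FI.mem_add (FI.mem_add (mem_sum3 (x := fun a => (D (EuclideanSpace.single a (1 : ℝ))) a *
            (rc a / ‖rc‖ * (nbr k + (if hshift k then ξ else 0)) a - en * (Nc a / ‖Nc‖) * (nbr k' + (if hshift k' then ξ else 0)) a))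
          fun a => FI.mem_mul (hD a a) (hCU a a))
        (FI.mem_mul (hD 0 1) (FI.mem_add (hCU 0 1) (hCU 1 0)))) (FI.mem_mul (hD 0 2) (FI.mem_add (hCU 0 2) (hCU 2 0))))
        (FI.mem_mul (hD 1 2) (FI.mem_add (hCU 1 2) (hCU 2 1)))
    · simp only [cTX]
      exact mem_sum3 (x := fun b => (ξ - ξc) b *
        ((if hshift k then ∑ a : Fin 3, (c (Sum.inl (a, b)) : ℝ) / SC * (rc a / ‖rc‖) else 0) -
          en * (if hshift k' then ∑ a : Fin 3, (c (Sum.inl (a, b)) : ℝ) / SC * (Nc a / ‖Nc‖) else 0))) fun b => FI.mem_mul (mem_wxFI hξb b) (hCX b)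
  have hq1m : FI.mem (|⟪rc, n'⟫ / ‖rc‖| * (‖N - Nc‖ ^ 2 / (2 * (‖Nc‖ - ‖N - Nc‖)))) q1 := by
    have e : |⟪rc, n'⟫ / ‖rc‖| * (‖N - Nc‖ ^ 2 / (2 * (‖Nc‖ - ‖N - Nc‖))) =
        (|en| * ‖N - Nc‖ ^ 2) / ((‖Nc‖ - ‖N - Nc‖) * ((2 : ℤ) : ℝ)) := by rw [hen]; push_cast; ring
    rw [e]
    refine FI.mem_divPos hq1 ?_ hden1
    rw [hnN]
    exact FI.mem_mul (mem_absFI henm) (FI.mem_sqr (hρ k'))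
  have hq2m : FI.mem ((‖R k - Rc k‖ + ‖N - Nc‖) ^ 2 / (2 * (‖rc‖ - (‖R k - Rc k‖ + ‖N - Nc‖)))) q2 := by
    have e : (‖R k - Rc k‖ + ‖N - Nc‖) ^ 2 / (2 * (‖rc‖ - (‖R k - Rc k‖ + ‖N - Nc‖))) =
        (‖R k - Rc k‖ + ‖N - Nc‖) ^ 2 / ((‖rc‖ - (‖R k - Rc k‖ + ‖N - Nc‖)) * ((2 : ℤ) : ℝ)) := by push_cast; ring
    rw [e]
    refine FI.mem_divPos hq2 ?_ hden2
    rw [hnN]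
    exact FI.mem_sqr (FI.mem_add (hρ k) (hρ k'))
  have htot := le_hi_of_mem (FI.mem_add (FI.mem_add (FI.mem_add hrcN hTU) hq1m) hq2m)
  have hmain' := mul_le_mul_of_nonneg_right main hS.le
  exact hmain'.trans htot

/-- ★★ **THE ROTATED PAIR BOUND** from a passed `cPairOKR` (`…CentredPair.norm_pair_le_of_cPairOK` with pattern `R n_k`). [folklore chaining] -/
theorem norm_pair_le_of_cPairOKR (hsym : c (Sum.inl (1, 0)) = c (Sum.inl (0, 1)) ∧ c (Sum.inl (2, 0)) = c (Sum.inl (0, 2)) ∧ c (Sum.inl (2, 1)) = c (Sum.inl (1, 2)))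
    (U : E3 →L[ℝ] E3) (ξ : E3) (hsa : ∀ v v' : E3, ⟪U v, v'⟫ = ⟪v, U v'⟫)
    (hbox : ∀ ab : Fin 3 × Fin 3, |(U (EuclideanSpace.single ab.2 (1 : ℝ))) ab.1 - (c (Sum.inl ab) : ℝ) / SC| ≤ (w (Sum.inl ab) : ℝ) / SC)
    (hξb : ∀ i : Fin 3, |ξ i - (c (Sum.inr i) : ℝ) / SC| ≤ (w (Sum.inr i) : ℝ) / SC) (k k' : Fin 12)
    (q : Fin 4 → ℤ) (Riso : E3 →ₗᵢ[ℝ] E3) (hRiso : ∀ (x : E3) (i : Fin 3), Riso x i = ∑ j, cayQ q i j * x j) (hNq : 0 < cayN q)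
    (hOK : cPairOKR c w (scaleL (fun ab => c (Sum.inl ab))) q k k' = true) :
    ‖nbrU U ξ k - ‖nbrU U ξ k'‖ • Riso (nbr k)‖ ^ 2 ≤ (4999 / 100000 : ℝ) ^ 2 * ((d2S c w (scaleL (fun ab => c (Sum.inl ab))) : ℝ) / SC) := by
  have hS : (0 : ℝ) < SC := by norm_num [SC]
  have hsym' : ∀ a b : Fin 3, c (Sum.inl (a, b)) = c (Sum.inl (b, a)) := by
    obtain ⟨s1, s2, s3⟩ := hsym
    intro a b
    fin_cases a <;> fin_cases b <;> first | rfl | exact s1.symm | exact s1 | exact s2.symm | exact s2 | exact s3.symm | exact s3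
  set cU : Fin 3 × Fin 3 → ℤ := fun ab => c (Sum.inl ab) with hcU
  set L : ℤ := scaleL cU with hL
  set lam : ℝ := (L : ℝ) / SC with hlam
  set V : E3 →L[ℝ] E3 := U - lam • (1 : E3 →L[ℝ] E3) with hVdef
  set Uc : E3 →L[ℝ] E3 := cenMap c with hUc
  set ξc : E3 := cenShuf c with hξc
  set Vc : E3 →L[ℝ] E3 := Uc - lam • (1 : E3 →L[ℝ] E3) with hVcdef
  have hV : ∀ x : E3, U x = lam • x + V x := fun x => by simp [hVdef]
  have hVc : ∀ x : E3, Uc x = lam • x + Vc x := fun x => by simp [hVcdef]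
  set R : Fin 12 → E3 := fun j => rReal V ξ lam j with hRdef
  set Rc : Fin 12 → E3 := fun j => rReal Vc ξc lam j with hRcdef
  have hdk : ∀ j, nbrU U ξ j = lam • nbr j + R j := fun j => nbrU_eq_smul_add_rReal hV ξ j
  have hdkc : ∀ j, nbrU Uc ξc j = lam • nbr j + Rc j := fun j => nbrU_eq_smul_add_rReal hVc ξc j
  -- memberships: box data and centre data
  have hX : ∀ i, FI.mem (ξ i) (shufFI c w i) := fun i => mem_shufFI (hξb i)
  have hLm : FI.mem lam (FI.ofScaled L) := FI.mem_ofScaled _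
  have hboxc : ∀ ab : Fin 3 × Fin 3, |(Uc (EuclideanSpace.single ab.2 (1 : ℝ))) ab.1 - (c (Sum.inl ab) : ℝ) / SC| ≤ (zW (Sum.inl ab) : ℝ) / SC :=
    fun ab => cenMap_box c ab
  have hξcb : ∀ i : Fin 3, |ξc i - (c (Sum.inr i) : ℝ) / SC| ≤ (zW (Sum.inr i) : ℝ) / SC := fun i => cenShuf_box c i
  have hE'c : ∀ ab : Fin 3 × Fin 3, FI.mem ((Vc (EuclideanSpace.single ab.2 (1 : ℝ))) ab.1) (cE0 c L ab) :=
    FrustratedLawDichotomyStrainedPatchHomEntryFit.mem_devFI Uc L hboxc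
  have hXc : ∀ i, FI.mem (ξc i) (cX0 c i) := fun i => mem_shufFI (hξcb i)
  have hRc : ∀ j a, FI.mem ((Rc j) a) (cRc c L j a) := fun j a => mem_rVec Vc ξc hE'c hXc hLm j a
  have hΔ : ∀ j a, FI.mem ((R j - Rc j) a) (cDR c w j a) := fun j a => mem_cDR U ξ lam hbox hξb j a
  have hρ : ∀ j, FI.mem ‖R j - Rc j‖ (cRho c w j) := fun j => mem_cRho U ξ lam hbox hξb j
  -- centre norms for `k'`
  have hPc : FI.mem ⟪Rc k', nbr k'⟫ (rP (cE0 c L) (cX0 c) (FI.ofScaled L) k') := mem_dot3 (hRc k') (mem_nbrFI k')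
  have hQc : FI.mem (‖Rc k'‖ ^ 2) (rSq (cE0 c L) (cX0 c) (FI.ofScaled L) k') := by
    rw [← real_inner_self_eq_norm_sq]; exact mem_dot3 (hRc k') (hRc k')
  have hlam_nbr : ∀ j, ‖nbrU Uc ξc j‖ ^ 2 = (lam ^ 2 + lam * ⟪Rc j, nbr j⟫ * ((2 : ℤ) : ℝ)) + ‖Rc j‖ ^ 2 := fun j => by
    rw [hdkc, norm_add_sq_real, norm_smul, Real.norm_eq_abs, norm_nbr, mul_one, sq_abs, real_inner_smul_left, real_inner_comm]
    push_cast; ring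
  have hNc2 : FI.mem (‖nbrU Uc ξc k'‖ ^ 2) (nrm2 (cE0 c L) (cX0 c) (FI.ofScaled L) k') := by
    rw [hlam_nbr]
    exact FI.mem_add (FI.mem_add (FI.mem_sqr hLm) (FI.mem_mulInt (FI.mem_mul hLm hPc) 2)) hQc
  have hNcN : FI.mem ‖nbrU Uc ξc k'‖ (cNcN c L k') := by
    have := FI.mem_sqrt hNc2
    rwa [Real.sqrt_sq (norm_nonneg _)] at this
  have hDc : FI.mem (‖nbrU Uc ξc k'‖ - lam) (cDlt c L k') := by
    have := FI.mem_sqrt hNc2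
    rw [Real.sqrt_sq (norm_nonneg _)] at this
    exact FI.mem_sub this hLm
  -- the objects of `pairResidual_le`
  set N : E3 := nbrU U ξ k' with hNdef
  set Nc : E3 := nbrU Uc ξc k' with hNcdef
  -- the rotated pattern direction `n' = Q n_k` and its enclosure
  set n' : E3 := Riso (nbr k) with hn'def
  have hn' : ‖n'‖ = 1 := by rw [hn'def, Riso.norm_map, norm_nbr]
  have hNpos : 0 < (cayN q).toNat := by omega
  have hNcast : (((cayN q).toNat : ℕ) : ℝ) = (cayN q : ℝ) := by
    have : ((cayN q).toNat : ℤ) = cayN q := Int.toNat_of_nonneg hNq.le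
    exact_mod_cast this
  have hQn : ∀ a, FI.mem (n' a) (qnFI q k a) := fun a => by
    rw [hn'def, hRiso (nbr k) a, Fin.sum_univ_three]
    have e : ∀ j, cayQ q a j = ((cayM q a j : ℤ) : ℝ) / (((cayN q).toNat : ℕ) : ℝ) := fun j => by rw [hNcast]; rfl
    rw [e 0, e 1, e 2]
    exact FI.mem_add (FI.mem_add (FI.mem_mul (FI.mem_ofFrac _ hNpos) (mem_nbrFI k 0)) (FI.mem_mul (FI.mem_ofFrac _ hNpos) (mem_nbrFI k 1)))
      (FI.mem_mul (FI.mem_ofFrac _ hNpos) (mem_nbrFI k 2))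
  set rc : E3 := Rc k + lam • (nbr k - n') - (‖Nc‖ - lam) • n' with hrc
  have hrcv : ∀ a, FI.mem (rc a) (cRcvR c L q k k' a) := fun a => by
    have e : rc a = ((Rc k) a + lam * ((nbr k) a - n' a)) - (‖Nc‖ - lam) * n' a := by
      simp only [hrc, PiLp.sub_apply, PiLp.add_apply, PiLp.smul_apply, smul_eq_mul]
    rw [e]
    exact FI.mem_sub (FI.mem_add (hRc k a) (FI.mem_mul hLm (FI.mem_sub (mem_nbrFI k a) (hQn a)))) (FI.mem_mul hDc (hQn a))
  have hrcN : FI.mem ‖rc‖ (cRcNR c L q k k') := by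
    have h2 : FI.mem (‖rc‖ ^ 2) (dot3 (cRcvR c L q k k') (cRcvR c L q k k')) := by
      rw [← real_inner_self_eq_norm_sq]; exact mem_dot3 hrcv hrcv
    have := FI.mem_sqrt h2
    rwa [Real.sqrt_sq (norm_nonneg _)] at this
  have hNcv : ∀ a, FI.mem (Nc a) (cNc c L k' a) := fun a => by
    have e : Nc a = lam * (nbr k') a + (Rc k') a := by
      simp only [hNcdef, hdkc, PiLp.add_apply, PiLp.smul_apply, smul_eq_mul]
    rw [e]
    exact FI.mem_add (FI.mem_mul hLm (mem_nbrFI k' a)) (hRc k' a)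
  -- identities
  have hsplit : nbrU U ξ k - ‖N‖ • n' = (R k + lam • (nbr k - n')) - (‖N‖ - lam) • n' := by
    rw [hdk, smul_sub, sub_smul]; abel
  have eΔ : R k + lam • (nbr k - n') - (Rc k + lam • (nbr k - n')) = R k - Rc k := by abel
  have hNsub : N - Nc = R k' - Rc k' := by
    simp only [hNdef, hNcdef, hdk, hdkc]; abel
  have hnN : ‖N - Nc‖ = ‖R k' - Rc k'‖ := by rw [hNsub]
  -- (T) the triangle bound
  have hT : ‖(R k + lam • (nbr k - n')) - (‖N‖ - lam) • n'‖ ≤ ‖rc‖ + ‖R k - Rc k‖ + ‖R k' - Rc k'‖ := by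
    have e : (R k + lam • (nbr k - n')) - (‖N‖ - lam) • n' = rc + ((R k - Rc k) - (‖N‖ - ‖Nc‖) • n') := by
      simp only [hrc, sub_smul]; abel
    rw [e]
    have h1 := norm_add_le rc ((R k - Rc k) - (‖N‖ - ‖Nc‖) • n')
    have h2 := norm_sub_le (R k - Rc k) ((‖N‖ - ‖Nc‖) • n')
    have h3 : ‖(‖N‖ - ‖Nc‖) • n'‖ ≤ ‖R k' - Rc k'‖ := by
      rw [norm_smul, Real.norm_eq_abs, hn', mul_one, ← hnN]
      exact abs_norm_sub_norm_le N Nc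
    linarith
  have hTnum : ‖(R k + lam • (nbr k - n')) - (‖N‖ - lam) • n'‖ * SC ≤ (cPairTR c w L q k k' : ℝ) := by
    unfold cPairTR
    push_cast
    have a1 := le_hi_of_mem hrcN
    have a2 := le_hi_of_mem (hρ k)
    have a3 := le_hi_of_mem (hρ k')
    have h4 := mul_le_mul_of_nonneg_right hT hS.le
    rw [add_mul, add_mul] at h4
    linarith
  -- conclusion: a scaled bound `Bz` with `‖…‖·SC ≤ Bz` that passed `cTest` gives the squared estimate
  have key : ∀ Bz : ℤ, ‖(R k + lam • (nbr k - n')) - (‖N‖ - lam) • n'‖ * SC ≤ (Bz : ℝ) → cTest (d2S c w L) Bz = true →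
      ‖(R k + lam • (nbr k - n')) - (‖N‖ - lam) • n'‖ ^ 2 ≤ (4999 / 100000 : ℝ) ^ 2 * ((d2S c w L : ℝ) / SC) := by
    intro Bz hle ht
    simp only [cTest, Bool.and_eq_true, decide_eq_true_eq] at ht
    obtain ⟨h0, hsq⟩ := ht
    have h0' : (0 : ℝ) ≤ Bz := by exact_mod_cast h0
    have hsq' : (10000000000 : ℝ) * (Bz : ℝ) ^ 2 ≤ 24990001 * (d2S c w L : ℝ) * SC := by exact_mod_cast hsq
    have hn := norm_nonneg ((R k + lam • (nbr k - n')) - (‖N‖ - lam) • n')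
    have h1 : (‖(R k + lam • (nbr k - n')) - (‖N‖ - lam) • n'‖ * SC) ^ 2 ≤ (Bz : ℝ) ^ 2 := pow_le_pow_left₀ (by positivity) hle 2
    rw [show (4999 / 100000 : ℝ) ^ 2 * ((d2S c w L : ℝ) / SC) = 24990001 * (d2S c w L : ℝ) * SC / (10000000000 * SC ^ 2) by
      field_simp; ring]
    rw [le_div_iff₀ (by positivity)]
    nlinarith [h1, hsq']
  rw [hsplit]
  unfold cPairOKR at hOK
  simp only [Bool.or_eq_true] at hOK
  rcases hOK with hT' | hC'
  · exact key _ hTnum hT'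
  · obtain ⟨B, hB, htest⟩ := elim_false_eq_true hC'
    unfold cPairCR at hB
    obtain ⟨e, he, hB⟩ := Option.bind_eq_some_iff.1 hB
    obtain ⟨g, hg, hB⟩ := Option.bind_eq_some_iff.1 hB
    have hcore := norm_pair_le_cPairCoreR hsym U ξ hsa hbox hξb k k' q Riso hRiso hNq he hg hB
    rw [hsplit] at hcore
    exact key _ hcore htest

end Summit.AtomisticToContinuum.Crystallization.Theorems.FrustratedLawDichotomyStrainedPatchHomEntryFitHcpCentred

end
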